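import Summits.BirchSwinnertonDyer.BirchSwinnertonDyer.Theorems.PrintCf2SplitBadTwoLevelModelsPointed
import Summits.BirchSwinnertonDyer.BirchSwinnertonDyer.Theorems.PrintCf2SplitBadTwoLevelSurjOfClassProNullTwistedSlack
import Summits.BirchSwinnertonDyer.BirchSwinnertonDyer.Theorems.PrintCf2SplitBadTwoLocSurjOfLevels
import Summits.BirchSwinnertonDyer.BirchSwinnertonDyer.Theorems.PrintCf2SplitBadTwoLocSurjTrivialAssembly
import Summits.BirchSwinnertonDyer.BirchSwinnertonDyer.Theorems.PrintCf2SplitBadTwoTwistedLayerField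
import Summits.BirchSwinnertonDyer.BirchSwinnertonDyer.Theorems.PrintCf2SplitBadTwoUpperBaseLiftFrameLayersVLine
import Literature.NumberTheory.GaloisRepresentations.GaloisRepUnramifiedProofs
import HarnessLib

/-!
# Crux `PrintCf2.SplitBadTwoRankOneOfFacts` (stmt-BirchSwinnertonDyer-20368), M-LINE-PIN stub (R) `stub_xRegularInner` of the DECIDING child
# (`Cruxes/MainConjClauseAtSplitTwoQuad/Lines/m_line_pin.lean`): ROAD (b) ON THE `v`-LINE — (LSₙ) for SIGN-TWISTED `A ≅ ℚ_p/ℤ_p(ε)` at every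
# layer `K^{(v)}_n` of the `ℤ_p`-line unramified outside `v`, MODULO the twisted `v̄`-reading WITH SLACK `d` (B3d″ p711297 ∘ B3c p706017 ∘ models p707877)

Cell `bsd-print-cf2`, WIDTH seat `bsd-line-cf2-p1-w2` g15 (prover-bsd-line-cf2-p1-w2-g15-0); `--supports` helper (Theses-free).
HONEST FRAMING: nothing here closes the crux or a registered stub — ONE displayed hypothesis `hB5T` (the twisted `v̄`-reading with slack) remains;
BSD is not proved by any of this; no summit statement is proved by this seat. No definition, no named fact, no `sorry`.

WHY. m_line_pin's stub (R) (no `T₂`-torsion in the two-variable dual on DA7 frames) follows, for `θ` non-trivial on `ker κ₁`, from Greenberg–Vatsal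
local surjectivity (LSₙ,₁) over the layers of the `v`-LINE `κ₁` (unramified outside `v`; -w6 g7's socket p707323 / LEAD p706693). -w8 g5's road (b)
(p710454/p711504 `locSurj_layers_twisted`) is written for the `v̄`-line (`κ.IsUnramifiedOutside vbar`, `v̄` totally ramified, exact class level).
On the `v`-line `v̄` is INERT in `K^{(v)}_n` (residue degree `2^n`), so the `v̄`-reading is only available modulo `2^{M−n}` (-w4 g14 STATUS 07:47:05Z (5),
p707142 slack class-level; -w4 g14 line-generic assembly `…NormAtVbarTwistedAssemblyLine`). THIS FILE is the `v`-line twin of -w8 g5's §2–§3 with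
slack: same template as p708767 `locSurj_torsionExponent_trivial` / `locSurj_layers_trivial`, ε-twisted through the pointed models p707877, the
class-level through B3d″ p711297, `I_w ≤ ker κ₁ ≤ U_n` off `v`, «no relevant place splits completely in the `v`-line» p706901.
* §1 **`locSurj_torsionExponent_twisted_slack (d) … (U) (F F′) (hUF : galFixing K F = U) (ε) … (hB5T) (k)`** — (SUR_U) for every `p^k`-torsion target
  family, VERBATIM the `hLSk k` body of `UpperBaseLift.locSurj_of_forall_torsionExponent`; `hB5T` = B3d″'s `hB5` universally quantified over the
  model data (antecedent list = -w8 g5's DEFINITIVE hB5T list, STATUS 09:36:41Z, minus `[Finite N′]`), left disjunct `(p^(M−d) : ℤ) ∣ log val`.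
* §2 **`locSurj_layers_twisted_slack_vLine (d) … (κ₁) (hκ₁ : κ₁.IsUnramifiedOutside v) … (n) (hB5T : ∀ F′ …)`** — (LSₙ) at `U_n = κ₁.layerSubgroup n`,
  VERBATIM the `hLSn n` body of p706901 `UpperBaseLift.locSurj_of_layers_of_isUnramifiedOutside_v` / of p707323's socket at a general `A`.
The `charModule` instance with the (B3)/(B1)/(B2) trichotomy is the sequel `…LocSurjCharModuleVLine`. presearch: GV2000 §2 Prop. 2.1, Greenberg LNM 1716
§4 Props. 4.13–4.15, de Shalit III.2.3 — assembly of tree theorems, no new fact. beyond-print theorem: no.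

References: [GreenbergVatsal2000] §2 Prop. 2.1; [GreenbergLNM1716] §4 Props. 4.13–4.15; [MilneADT2006] I Thm. 4.10 (b); [deShalit1987] III.2.3.
-/

noncomputable section

open scoped Classical ContRepresentation Pointwise

set_option linter.dupNamespace false
set_option autoImplicit false

open CategoryTheory NumberField IsDedekindDomain Field ValuativeRel
open Literature.NumberTheory.EllipticCurves Literature.NumberTheory.EllipticCurves.GreenbergSelmer
open Literature.NumberTheory.EllipticCurves.GreenbergVatsal2000 Literature.NumberTheory.EllipticCurves.KellerYin2024
open Literature.NumberTheory.GaloisRepresentations Literature.NumberTheory.GaloisRepresentations.LocalWeilDatum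
open Literature.NumberTheory.GaloisRepresentations.DiscreteGaloisModule (SelmerStructure mu MuCarrier TateDual tateDual
  coindTateDualMor coindTateDualHom)
open Literature.NumberTheory.GaloisCohomology
open Literature.NumberTheory.IwasawaTheory
open Summit.BirchSwinnertonDyer.Rank1Residual.X11b.LocBridge

namespace Summit.BirchSwinnertonDyer.BirchSwinnertonDyer.Theorems.PrintCf2.LayerShapiroSlack

variable {K : Type} [Field K] [NumberField K] {p : ℕ} [Fact p.Prime]

/-! ## §1. (SUR_U) for sign-twisted `A ≅ ℚ_p/ℤ_p(ε)` over `U = Gal(K̄/F)`, every exponent, modulo the twisted `v̄`-reading with slack `d` -/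

/-- **(SUR_U) FOR EVERY `p^k`-TORSION TARGET FAMILY, SIGN-TWISTED COEFFICIENTS `A ≅ ℚ_p/ℤ_p(ε)`, over `U = Gal(K̄/F)`, MODULO THE TWISTED
`v̄`-READING WITH SLACK `d`** (`K` imaginary quadratic, `p = v v̄`, `F ⊆ F′ = F·K_ε` finite abelian over `K`, `I_w ≤ U` off `p`, `ε` unramified off
`p` outside the finite `Sε`). The displayed `hB5T` is B3d″'s `hB5` (p711297) universally quantified over the level-`M` model data of
`exists_signLevelModels_pointed` (p707877): at every `w′ ∣ v̄` of `F′`, `p^{M−d} ∣ ord_{w′}(b′)` OR the non-split escape. Conclusion VERBATIM the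
`hLSk k` body of `UpperBaseLift.locSurj_of_forall_torsionExponent`. [cite: GreenbergVatsal2000, §2 Prop. 2.1] [cite: deShalit1987, III.2.3]
[cite: MilneADT2006, Ch. I, Thm. 4.10 (b)] -/
theorem locSurj_torsionExponent_twisted_slack (d : ℕ) (hK : IsImaginaryQuadratic K) {v vbar : HeightOneSpectrum (𝓞 K)}
    (hv : ((p : ℕ) : 𝓞 K) ∈ v.asIdeal) (hvbar : ((p : ℕ) : 𝓞 K) ∈ vbar.asIdeal) (hne : vbar ≠ v)
    (hall : ∀ w : HeightOneSpectrum (𝓞 K), ((p : ℕ) : 𝓞 K) ∈ w.asIdeal → w = v ∨ w = vbar)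
    (U : Subgroup (absoluteGaloisGroup K)) [U.Normal] (hUopen : IsOpen (U : Set (absoluteGaloisGroup K)))
    [Fintype (absoluteGaloisGroup K ⧸ U)]
    (F F' : IntermediateField K (AlgebraicClosure K)) [FiniteDimensional K F'] [IsAbelianGalois K F'] [NumberField F']
    [(galFixing K F').Normal] (hUF : galFixing K F = U) (ε : absoluteGaloisGroup K →* ℤˣ)
    (hε : IsOpen ((ε.ker : Subgroup (absoluteGaloisGroup K)) : Set (absoluteGaloisGroup K)))
    (hU' : galFixing K F' ≤ U) (hεU' : ∀ u ∈ galFixing K F', ε u = 1)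
    (hker : ∀ u ∈ U, ε u = 1 → u ∈ galFixing K F')
    (hIU : ∀ w : HeightOneSpectrum (𝓞 K), ((p : ℕ) : 𝓞 K) ∉ w.asIdeal → GreenbergSelmer.inertia w ≤ U)
    (Sε : Finset (HeightOneSpectrum (𝓞 K)))
    (hSε : ∀ w : HeightOneSpectrum (𝓞 K), w ∉ Sε → ((p : ℕ) : 𝓞 K) ∉ w.asIdeal → ∀ τ ∈ GreenbergSelmer.inertia w, ε τ = 1)
    {A : Type} [AddCommGroup A] [DistribMulAction (absoluteGaloisGroup K) A] [TopologicalSpace A] [DiscreteTopology A]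
    (hA : ∀ a : A, IsOpen {σ : absoluteGaloisGroup K | σ • a = a})
    (hAε : ∀ (σ : absoluteGaloisGroup K) (a : A), σ • a = ((ε σ : ℤˣ) : ℤ) • a) (e : A ≃+ QpModZp p)
    (hB5T : ∀ (M : ℕ) {N : Type} [AddCommGroup N] [DistribMulAction (absoluteGaloisGroup K) N] [TopologicalSpace N] [DiscreteTopology N]
      [Finite N] {N' : Type} [AddCommGroup N'] [DistribMulAction (absoluteGaloisGroup K) N'] [TopologicalSpace N'] [DiscreteTopology N']
      (hN : ∀ m : N, IsOpen {σ : absoluteGaloisGroup K | σ • m = m}) (hN' : ∀ m : N', IsOpen {σ : absoluteGaloisGroup K | σ • m = m})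
      (_hNε : ∀ (σ : absoluteGaloisGroup K) (x : N), σ • x = ((ε σ : ℤˣ) : ℤ) • x)
      (_hMN : ∀ x : N, p ^ M • x = 0) (_hMN' : ∀ x : N', p ^ M • x = 0)
      (B : N →+ N' →+ MuCarrier K (p ^ M))
      (hB : ∀ (σ : absoluteGaloisGroup K) (m : N) (m' : N'), B (ofSMul N hN σ m) (ofSMul N' hN' σ m') = mu K (p ^ M) σ (B m m'))
      (_hBbij : Function.Bijective fun m' : N' ↦ B.flip m')
      (ι' : N' →+ Additive (AlgebraicClosure K)ˣ) (_hι'inj : Function.Injective ι')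
      (_hι' : ∀ (g : absoluteGaloisGroup K) (x : N'), Additive.toMul (ι' (g • x)) = (g • Additive.toMul (ι' x)) ^ ((ε g : ℤˣ) : ℤ))
      (m₀ : N) (_hι'B : ∀ m' : N', Additive.toMul (ι' m') = muVal K (p ^ M) (B m₀ m'))
      {s : absoluteGaloisGroup K ⧸ U → absoluteGaloisGroup K}
      (hs : ∀ y, (s y : absoluteGaloisGroup K ⧸ U) = y)
      (hs1 : s ((1 : absoluteGaloisGroup K) : absoluteGaloisGroup K ⧸ U) = 1)
      (φ : contOneCocycles (discreteTopRep U N')),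
      galoisCohomology.localization (((ofSMul N hN).coind U hUopen).tateDual (p ^ M)) (Sum.inr vbar) 1
          (cohomologyMap (coindTateDualMor (ofSMul N hN) (ofSMul N' hN') U B hUopen hB) 1
            (shapiroLift (ofSMul N' hN').toTopRep U hUopen hs hs1 (oneCocycleClass _ φ))) ∈
        (LocalInvariants.canonical K (p ^ M)).dualLocalCondition ((ofSMul N hN).coind U hUopen) (Sum.inr vbar)
          (DiscreteGaloisModule.unramifiedSubgroup (GaloisRep.toLocal vbar ((ofSMul N hN).coind U hUopen)) 1) →
      ∀ β : (AlgebraicClosure K)ˣ,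
        (∀ u : galFixing K F', Additive.toMul (ι' (φ.1 ⟨u, hU' u.2⟩)) = (u : absoluteGaloisGroup K) • β / β) →
        ∀ b : F', ((b : F') : AlgebraicClosure K) = ((β ^ p ^ M : (AlgebraicClosure K)ˣ) : AlgebraicClosure K) →
        ∀ w' : vbar.Extension (𝓞 F'),
          ((p ^ (M - d) : ℕ) : ℤ) ∣ WithZero.log (w'.1.valuation F' b) ∨
          ∃ 𝔓 : Ideal (absIntegers (𝓞 K) K),
            𝔓.comap (ringOfIntegersToIntegralClosure (k := K) (Ω := AlgebraicClosure K) F') = w'.1.asIdeal ∧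
            ∃ s ∈ U, ε s ≠ 1 ∧ s • 𝔓 = 𝔓)
    (k : ℕ) :
    ∀ (T : Finset (HeightOneSpectrum (𝓞 K))), (∀ w ∈ T, ((p : ℕ) : 𝓞 K) ∉ w.asIdeal ∨ w = vbar) →
      ∀ τ : (w : HeightOneSpectrum (𝓞 K)) →
        DoubleCoset.Quotient (decomp (K := K) w : Set (absoluteGaloisGroup K)) (U : Set (absoluteGaloisGroup K)) →
          subgroupH1 (decompIn U w) A,
      (∀ w ∈ T, ∀ q, p ^ k • τ w q = 0) →
      ∃ z : subgroupH1 U A,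
        (∀ w ∈ T, ∀ q : DoubleCoset.Quotient (decomp (K := K) w : Set (absoluteGaloisGroup K)) (U : Set (absoluteGaloisGroup K)),
          resOfLe A (inertiaIn_le_decompIn U w)
            (resH1Hom (decompInToH U w) (AddMonoidHom.id A) (fun _ _ ↦ rfl) (conjH1 U A q.out z) - τ w q) = 0) ∧
        (∀ w : HeightOneSpectrum (𝓞 K), w ∉ T → (((p : ℕ) : 𝓞 K) ∉ w.asIdeal ∨ w = vbar) →
          ∀ σ : absoluteGaloisGroup K, conjH1 U A σ z ∈ GreenbergVatsal2000.unramifiedKer U A w) := by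
  subst hUF
  -- the level `M` of the class-level twisted (PRO-NULL)_U with slack `d`, through B3d″
  obtain ⟨M, hkM, -, hM⟩ := LayerShapiro.exists_level_levelSurj_of_classProNull_twisted_slack (p := p) d hK hv hvbar hne hall F F' ε
    hU' hεU' hker hUopen k
  -- the sign-twisted models at `(k, M)`
  obtain ⟨N₀, N, N₀', N', _, _, _, _, _, _, _, _, _, _, _, _, _, _, _, _, _, _, hN₀, hN, hN₀', hN', j, ι₀, ι, B, B₀, jD, ι', ι₀',
    hN₀ε, hNε, hMN, hj, hι₀eq, hι₀inj, hrange, hιeq, hcomp, hdiv, hMN', hB, hBbij, hB₀, hjD, hBj, hι'inj, hι'eq, hι₀'inj, hι₀'eq,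
    hι₀'surj, htι, m₀, hι'B⟩ :=
    LayerShapiro.exists_signLevelModels_pointed (p := p) ε hε hAε e k M hkM
  -- unramifiedness of the coinduced module off `Sε ∪ {p-places}`; the ramified disjunction
  have hUnr : ∀ w : HeightOneSpectrum (𝓞 K), w ∉ Sε → ((p : ℕ) : 𝓞 K) ∉ w.asIdeal →
      GaloisRep.IsUnramifiedAt w ((ofSMul N hN).coind (galFixing K F) hUopen) := fun w hwS hw ↦
    LayerShapiro.isUnramifiedAt_coind_of_inertia_le (galFixing K F) hUopen hN w (hIU w hw) fun σ hσ x ↦ by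
      rw [hNε, hSε w hwS hw σ hσ, Units.val_one, one_zsmul]
  have hram : ∀ w : HeightOneSpectrum (𝓞 K), ((p : ℕ) : 𝓞 K) ∉ w.asIdeal →
      GaloisRep.IsUnramifiedAt w ((ofSMul N hN).coind (galFixing K F) hUopen) ∨
      (GreenbergSelmer.inertia w ≤ galFixing K F ∧ ∃ τ ∈ GreenbergSelmer.inertia w, ε τ ≠ 1) := by
    intro w hw
    by_cases h : ∀ τ ∈ GreenbergSelmer.inertia w, ε τ = 1
    · exact Or.inl (LayerShapiro.isUnramifiedAt_coind_of_inertia_le (galFixing K F) hUopen hN w (hIU w hw) fun σ hσ x ↦ by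
        rw [hNε, h σ hσ, Units.val_one, one_zsmul])
    · push Not at h
      exact Or.inr ⟨hIU w hw, h⟩
  -- B3c over B3d″, with the displayed twisted `v̄`-reading
  refine LayerShapiro.locSurj_torsionExponent_of_levelSurj (galFixing K F) hA vbar k hdiv ι₀ hι₀eq hι₀inj hrange ι hιeq j hj hcomp ?_
  exact hM hN₀ hN hN₀' hN' hMN hMN' j hj B hB hBbij B₀ hB₀ jD hjD hBj ι' hι'inj hι'eq ι₀' hι₀'inj hι₀'eq hι₀'surj htι Sε hUnr hram
    (fun hs hs1 φ hφ β hβ b hb w' ↦ hB5T M hN hN' hNε hMN hMN' B hB hBbij ι' hι'inj hι'eq m₀ hι'B hs hs1 φ hφ β hβ b hb w')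


/-! ## §2. (LSₙ) for sign-twisted `A ≅ ℚ_p/ℤ_p(ε)` on every layer of the `v`-LINE, modulo the twisted `v̄`-reading with slack -/

/-- **(LSₙ) FOR SIGN-TWISTED `A ≅ ℚ_p/ℤ_p(ε)` AT EVERY LAYER `U_n = κ₁.layerSubgroup n` OF THE `v`-LINE** (`κ₁` unramified outside `v`; `K`
imaginary quadratic, `p = v v̄`) MODULO the displayed twisted `v̄`-reading WITH SLACK `d` (`hB5T`, quantified over every admissible twisted layer
field `F′ ⊇ K^{(v)}_n` with `Gal(K̄/F′) = {u ∈ U_n : ε u = 1}` and over the level-`M` model data) — VERBATIM the `hLSn n` body of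
`UpperBaseLift.locSurj_of_layers_of_isUnramifiedOutside_v` (p706901) / of -w6 g7's socket `XRegInner.stub_xRegularInner_of_locSurjLayers₁_of_nontrivial`
at `charModule`. Inputs: §1 at `F′ :=` -w4 g14's `exists_twistedLayerField κ₁ n ε` and `F := K^{(v)}_n`; `I_w ≤ ker κ₁ ≤ U_n` off `v`;
«no relevant place splits completely in the `v`-line» (p706901). [cite: GreenbergVatsal2000, §2 Prop. 2.1] [cite: GreenbergLNM1716, §4 Props. 4.13–4.15]
[cite: deShalit1987, III.2.3] -/
theorem locSurj_layers_twisted_slack_vLine (d : ℕ) (hK : IsImaginaryQuadratic K) {v vbar : HeightOneSpectrum (𝓞 K)}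
    (hv : ((p : ℕ) : 𝓞 K) ∈ v.asIdeal) (hvbar : ((p : ℕ) : 𝓞 K) ∈ vbar.asIdeal) (hne : vbar ≠ v)
    (hall : ∀ w : HeightOneSpectrum (𝓞 K), ((p : ℕ) : 𝓞 K) ∈ w.asIdeal → w = v ∨ w = vbar)
    (κ₁ : ZpExtension K p) (hκ₁ : κ₁.IsUnramifiedOutside v) (ε : absoluteGaloisGroup K →* ℤˣ)
    (hε : IsOpen ((ε.ker : Subgroup (absoluteGaloisGroup K)) : Set (absoluteGaloisGroup K)))
    (Sε : Finset (HeightOneSpectrum (𝓞 K)))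
    (hSε : ∀ w : HeightOneSpectrum (𝓞 K), w ∉ Sε → ((p : ℕ) : 𝓞 K) ∉ w.asIdeal → ∀ τ ∈ GreenbergSelmer.inertia w, ε τ = 1)
    {A : Type} [AddCommGroup A] [DistribMulAction (absoluteGaloisGroup K) A] [TopologicalSpace A] [DiscreteTopology A]
    (hA : ∀ a : A, IsOpen {σ : absoluteGaloisGroup K | σ • a = a})
    (hAε : ∀ (σ : absoluteGaloisGroup K) (a : A), σ • a = ((ε σ : ℤˣ) : ℤ) • a) (e : A ≃+ QpModZp p)
    (n : ℕ) [Fintype (absoluteGaloisGroup K ⧸ κ₁.layerSubgroup n)]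
    (hB5T : ∀ (F' : IntermediateField K (AlgebraicClosure K)) [FiniteDimensional K F'] [IsAbelianGalois K F'] [NumberField F']
      [(galFixing K F').Normal] (hU' : galFixing K F' ≤ κ₁.layerSubgroup n) (_hεU' : ∀ u ∈ galFixing K F', ε u = 1)
      (_hker : ∀ u ∈ κ₁.layerSubgroup n, ε u = 1 → u ∈ galFixing K F')
      (M : ℕ) {N : Type} [AddCommGroup N] [DistribMulAction (absoluteGaloisGroup K) N] [TopologicalSpace N] [DiscreteTopology N]
      [Finite N] {N' : Type} [AddCommGroup N'] [DistribMulAction (absoluteGaloisGroup K) N'] [TopologicalSpace N'] [DiscreteTopology N']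
      (hN : ∀ m : N, IsOpen {σ : absoluteGaloisGroup K | σ • m = m}) (hN' : ∀ m : N', IsOpen {σ : absoluteGaloisGroup K | σ • m = m})
      (_hNε : ∀ (σ : absoluteGaloisGroup K) (x : N), σ • x = ((ε σ : ℤˣ) : ℤ) • x)
      (_hMN : ∀ x : N, p ^ M • x = 0) (_hMN' : ∀ x : N', p ^ M • x = 0)
      (B : N →+ N' →+ MuCarrier K (p ^ M))
      (hB : ∀ (σ : absoluteGaloisGroup K) (m : N) (m' : N'), B (ofSMul N hN σ m) (ofSMul N' hN' σ m') = mu K (p ^ M) σ (B m m'))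
      (_hBbij : Function.Bijective fun m' : N' ↦ B.flip m')
      (ι' : N' →+ Additive (AlgebraicClosure K)ˣ) (_hι'inj : Function.Injective ι')
      (_hι' : ∀ (g : absoluteGaloisGroup K) (x : N'), Additive.toMul (ι' (g • x)) = (g • Additive.toMul (ι' x)) ^ ((ε g : ℤˣ) : ℤ))
      (m₀ : N) (_hι'B : ∀ m' : N', Additive.toMul (ι' m') = muVal K (p ^ M) (B m₀ m'))
      {s : absoluteGaloisGroup K ⧸ κ₁.layerSubgroup n → absoluteGaloisGroup K}
      (hs : ∀ y, (s y : absoluteGaloisGroup K ⧸ κ₁.layerSubgroup n) = y)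
      (hs1 : s ((1 : absoluteGaloisGroup K) : absoluteGaloisGroup K ⧸ κ₁.layerSubgroup n) = 1)
      (φ : contOneCocycles (discreteTopRep (κ₁.layerSubgroup n) N')),
      galoisCohomology.localization (((ofSMul N hN).coind (κ₁.layerSubgroup n) (κ₁.isOpen_layerSubgroup n)).tateDual (p ^ M))
          (Sum.inr vbar) 1
          (cohomologyMap (coindTateDualMor (ofSMul N hN) (ofSMul N' hN') (κ₁.layerSubgroup n) B (κ₁.isOpen_layerSubgroup n) hB) 1
            (shapiroLift (ofSMul N' hN').toTopRep (κ₁.layerSubgroup n) (κ₁.isOpen_layerSubgroup n) hs hs1 (oneCocycleClass _ φ))) ∈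
        (LocalInvariants.canonical K (p ^ M)).dualLocalCondition ((ofSMul N hN).coind (κ₁.layerSubgroup n) (κ₁.isOpen_layerSubgroup n))
          (Sum.inr vbar)
          (DiscreteGaloisModule.unramifiedSubgroup
            (GaloisRep.toLocal vbar ((ofSMul N hN).coind (κ₁.layerSubgroup n) (κ₁.isOpen_layerSubgroup n))) 1) →
      ∀ β : (AlgebraicClosure K)ˣ,
        (∀ u : galFixing K F', Additive.toMul (ι' (φ.1 ⟨u, hU' u.2⟩)) = (u : absoluteGaloisGroup K) • β / β) →
        ∀ b : F', ((b : F') : AlgebraicClosure K) = ((β ^ p ^ M : (AlgebraicClosure K)ˣ) : AlgebraicClosure K) →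
        ∀ w' : vbar.Extension (𝓞 F'),
          ((p ^ (M - d) : ℕ) : ℤ) ∣ WithZero.log (w'.1.valuation F' b) ∨
          ∃ 𝔓 : Ideal (absIntegers (𝓞 K) K),
            𝔓.comap (ringOfIntegersToIntegralClosure (k := K) (Ω := AlgebraicClosure K) F') = w'.1.asIdeal ∧
            ∃ s ∈ κ₁.layerSubgroup n, ε s ≠ 1 ∧ s • 𝔓 = 𝔓) :
    ∀ (T : Finset (HeightOneSpectrum (𝓞 K))), (∀ w ∈ T, ((p : ℕ) : 𝓞 K) ∉ w.asIdeal ∨ w = vbar) →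
      ∀ τ : (w : HeightOneSpectrum (𝓞 K)) →
        DoubleCoset.Quotient (decomp (K := K) w : Set (absoluteGaloisGroup K)) (κ₁.layerSubgroup n : Set (absoluteGaloisGroup K)) →
          subgroupH1 (decompIn (κ₁.layerSubgroup n) w) A,
      ∃ z : subgroupH1 (κ₁.layerSubgroup n) A,
        (∀ w ∈ T, ∀ q : DoubleCoset.Quotient (decomp (K := K) w : Set (absoluteGaloisGroup K))
            (κ₁.layerSubgroup n : Set (absoluteGaloisGroup K)),
          resOfLe A (inertiaIn_le_decompIn (κ₁.layerSubgroup n) w)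
            (resH1Hom (decompInToH (κ₁.layerSubgroup n) w) (AddMonoidHom.id A) (fun _ _ ↦ rfl)
              (conjH1 (κ₁.layerSubgroup n) A q.out z) - τ w q) = 0) ∧
        (∀ w : HeightOneSpectrum (𝓞 K), w ∉ T → (((p : ℕ) : 𝓞 K) ∉ w.asIdeal ∨ w = vbar) →
          ∀ σ : absoluteGaloisGroup K, conjH1 (κ₁.layerSubgroup n) A σ z ∈
            GreenbergVatsal2000.unramifiedKer (κ₁.layerSubgroup n) A w) := by
  -- the layer field `F` (ε = 1) and the twisted layer field `F′`
  have hε1 : IsOpen ((1 : absoluteGaloisGroup K →* ℤˣ).ker : Set (absoluteGaloisGroup K)) := by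
    rw [MonoidHom.ker_one]; exact isOpen_univ
  obtain ⟨F, hFU, -, hfdF, habF, hnfF, hnF⟩ := KummerUDict.exists_twistedLayerField κ₁ n (1 : absoluteGaloisGroup K →* ℤˣ) hε1
  haveI := hfdF; haveI := habF; haveI := hnfF
  have hUF : galFixing K F = κ₁.layerSubgroup n := by rw [hFU, MonoidHom.ker_one, inf_top_eq]
  obtain ⟨F', hF'U, -, hfd, hab, hnf, hnF'⟩ := KummerUDict.exists_twistedLayerField κ₁ n ε hε
  haveI := hfd; haveI := hab; haveI := hnf; haveI := hnF'
  have hU' : galFixing K F' ≤ κ₁.layerSubgroup n := hF'U ▸ inf_le_left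
  have hεU' : ∀ u ∈ galFixing K F', ε u = 1 := fun u hu ↦ by
    rw [hF'U] at hu
    exact (MonoidHom.mem_ker).1 (Subgroup.mem_inf.1 hu).2
  have hker : ∀ u ∈ κ₁.layerSubgroup n, ε u = 1 → u ∈ galFixing K F' := fun u hu hεu ↦ by
    rw [hF'U]
    exact Subgroup.mem_inf.2 ⟨hu, (MonoidHom.mem_ker).2 hεu⟩
  -- torsion, inertia, non-splitting
  have htor : ∀ a : A, ∃ k : ℕ, p ^ k • a = 0 := fun a ↦ by
    obtain ⟨k, hk⟩ := QpModZp.exists_pow_nsmul_eq_zero (e a)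
    exact ⟨k, e.injective (by rw [map_nsmul, hk, map_zero])⟩
  have hIU : ∀ w : HeightOneSpectrum (𝓞 K), ((p : ℕ) : 𝓞 K) ∉ w.asIdeal → GreenbergSelmer.inertia w ≤ κ₁.layerSubgroup n :=
    fun w hw ↦ (hκ₁.inertia_le fun h ↦ hw (by rw [h]; exact hv)).trans (κ₁.kerSubgroup_le_layerSubgroup n)
  refine UpperBaseLift.locSurj_layerSubgroup_of_forall_torsionExponent (M := A) κ₁ n htor
    (UpperBaseLift.not_decomp_le_kerSubgroup_of_isUnramifiedOutside_v hK hv hvbar hne κ₁ hκ₁) fun k ↦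
      locSurj_torsionExponent_twisted_slack d hK hv hvbar hne hall (κ₁.layerSubgroup n) (κ₁.isOpen_layerSubgroup n) F F' hUF ε hε
        hU' hεU' hker hIU Sε hSε hA hAε e ?_ k
  intro M N _ _ _ _ _ N' _ _ _ _ hN hN' hNε hMN hMN' B hB hBbij ι' hι'inj hι' m₀ hι'B s hs hs1 φ hφ β hβ b hb w'
  exact hB5T F' hU' hεU' hker M hN hN' hNε hMN hMN' B hB hBbij ι' hι'inj hι' m₀ hι'B hs hs1 φ hφ β hβ b hb w'

end Summit.BirchSwinnertonDyer.BirchSwinnertonDyer.Theorems.PrintCf2.LayerShapiroSlack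

end
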